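import Mathlib
import Summits.ValiantsHypothesis.ValiantsHypothesis.Theorems.TriangularDimersDivisionEasy.Negative.UnitH

/-!
# `TriangularDimersDivisionEasy` — negative lemma: a successful denominator lies in the EDGE IDEAL

Crux `stmt-ValiantsHypothesis-5067` (`Theses.DivisionGap.TriangularDimersDivisionEasy`, route
DivisionGap).  Standing disprover (cdisprove gen 1); strengthens `not_divisionEasy_with_unit_h`
(`h(0) ≠ 0` excluded) by a free substitution: the crux's polynomial ring has a variable `x_(v,w)` for
EVERY ordered pair of vertices, but `D_n` only uses the lattice edges.  Substituting `1` for every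
non-edge variable costs nothing (`complexity_subst_le`: replace input operands by constants),
fixes `D_n`, and turns any `h` having a monomial free of edge variables into one with non-zero
constant term.  Hence

  `not_divisionEasy_unless_edge_ideal :
     ¬ ∃ c, ∀ n, ∃ h, eval (nonEdgePoint n) h ≠ 0 ∧ L₊(D_n · h) + L₊(h) ≤ 2^((log₂ n + c)^c)`,

`nonEdgePoint` = edge variables `0`, all other variables `1`: in the normal form `D_n · h = g` every
monomial of a successful `h` contains an edge variable `x_(v,w)`, `v ∼ w`.
[cite: Valiant1980, §3 Thm 1]
-/

namespace Summit.ValiantsHypothesis.ValiantsHypothesis.Theorems.TriangularDimersDivisionEasy.Negative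

open Literature.Computability.AlgebraicComplexity
open MvPolynomial
open scoped BigOperators NNReal

set_option linter.dupNamespace false

noncomputable section

open Classical

/-! ## Substituting constants for some inputs of a circuit -/

section Subst

universe u v

variable {k : Type u} [CommSemiring k] {σ : Type v}

/-- Replace the input variable `i` by the constant `a` whenever `c i = some a`. [folklore] -/
def substOperand (c : σ → Option k) : ArithCircuit.Operand k σ → ArithCircuit.Operand k σ
  | .var i => match c i with
    | some a => .const a
    | none => .var i
  | u => u

/-- The same on gates. [folklore] -/
def substGate (c : σ → Option k) : ArithCircuit.Gate k σ → ArithCircuit.Gate k σ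
  | .sum args => .sum (args.map fun a => (a.1, substOperand c a.2))
  | .prod args => .prod (args.map (substOperand c))

/-- The same on circuits (size unchanged). [folklore] -/
def substCircuit (c : σ → Option k) (P : ArithCircuit k σ) : ArithCircuit k σ where
  gates := P.gates.map (substGate c)
  output := substOperand c P.output

/-- The substitution as a map of polynomials: `X i ↦ C a` if `c i = some a`, else `X i ↦ X i`. [folklore] -/
def substHom (c : σ → Option k) : MvPolynomial σ k →ₐ[k] MvPolynomial σ k :=
  bind₁ fun i => match c i with
    | some a => C a
    | none => X i

omit [CommSemiring k] in
/-- Size is unchanged. [folklore] -/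
theorem size_substCircuit (c : σ → Option k) (P : ArithCircuit k σ) : (substCircuit c P).size = P.size := by
  simp [substCircuit, ArithCircuit.size]

omit [CommSemiring k] in
/-- Fan-in two is preserved. [folklore] -/
theorem isFanInTwo_substCircuit (c : σ → Option k) {P : ArithCircuit k σ} (h : P.IsFanInTwo) :
    (substCircuit c P).IsFanInTwo := by
  intro g hg
  simp only [substCircuit, List.mem_map] at hg
  obtain ⟨g', hg', rfl⟩ := hg
  have := h g' hg'
  cases g' <;> simpa [substGate, ArithCircuit.Gate.fanIn, ArithCircuit.Gate.args] using this

/-- Operand semantics under substitution. [folklore] -/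
theorem eval_substOperand (c : σ → Option k) (vals : List (MvPolynomial σ k)) (u : ArithCircuit.Operand k σ) :
    (substOperand c u).eval (vals.map (substHom c)) = substHom c (u.eval vals) := by
  cases u with
  | var i =>
    simp only [substOperand, ArithCircuit.Operand.eval, substHom, bind₁_X_right]
    cases c i <;> rfl
  | const a => simp [substOperand, ArithCircuit.Operand.eval, substHom]
  | gate j =>
    simp only [substOperand, ArithCircuit.Operand.eval, List.getD_eq_getElem?_getD, List.getElem?_map]
    cases vals[j]? <;> simp

/-- Gate semantics under substitution. [folklore] -/
theorem eval_substGate (c : σ → Option k) (vals : List (MvPolynomial σ k)) (g : ArithCircuit.Gate k σ) :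
    (substGate c g).eval (vals.map (substHom c)) = substHom c (g.eval vals) := by
  cases g with
  | sum args =>
    simp only [substGate, ArithCircuit.Gate.eval, List.map_map, map_list_sum]
    congr 1
    apply List.map_congr_left
    intro a _
    simp only [Function.comp_apply, map_smul, eval_substOperand]
  | prod args =>
    simp only [substGate, ArithCircuit.Gate.eval, List.map_map, map_list_prod]
    congr 1
    apply List.map_congr_left
    intro u _
    simp only [Function.comp_apply, eval_substOperand]

/-- Value lists under substitution. [folklore] -/
theorem gateValues_subst (c : σ → Option k) (gs : List (ArithCircuit.Gate k σ)) :
    ArithCircuit.gateValues (gs.map (substGate c)) = (ArithCircuit.gateValues gs).map (substHom c) := by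
  induction gs using List.reverseRecOn with
  | nil => rfl
  | append_singleton gs g ih =>
    rw [List.map_append, List.map_singleton, ArithCircuit.gateValues_append_singleton,
      ArithCircuit.gateValues_append_singleton, ih, eval_substGate, List.map_append, List.map_singleton]

/-- The substituted circuit computes the substituted polynomial. [folklore] -/
theorem eval_substCircuit (c : σ → Option k) (P : ArithCircuit k σ) :
    (substCircuit c P).eval = substHom c P.eval := by
  change (substOperand c P.output).eval (ArithCircuit.gateValues (P.gates.map (substGate c))) = _
  rw [gateValues_subst, eval_substOperand]
  rfl

/-- **Substituting constants for inputs is free.** [folklore] -/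
theorem complexity_subst_le (c : σ → Option k) (f : MvPolynomial σ k) :
    complexity (substHom c f) ≤ complexity f := by
  obtain ⟨P, hP2, hPc, hPs⟩ := ArithCircuit.exists_computes_size_eq_complexity f
  rw [← hPs, ← size_substCircuit c P]
  refine ArithCircuit.complexity_le_size (isFanInTwo_substCircuit c hP2) ?_
  unfold ArithCircuit.Computes at hPc ⊢
  rw [eval_substCircuit, hPc]

end Subst

/-! ## The non-edge substitution -/

variable {n : ℕ}

/-- Substitute `1` for every non-edge variable (the edge variables stay). [folklore] -/
def nonEdgeSubst (n : ℕ) : Var n → Option ℝ≥0 := fun p => if Adj p.1 p.2 then none else some 1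

/-- The point: edge variables `0`, non-edge variables `1`. [folklore] -/
def nonEdgePoint (n : ℕ) : Var n → ℝ≥0 := fun p => if Adj p.1 p.2 then 0 else 1

/-- The substitution fixes `D_n` (which uses edge variables only). [folklore] -/
theorem substHom_triPM : substHom (nonEdgeSubst n) (triPM n) = triPM n := by
  unfold triPM
  rw [map_sum]
  refine Finset.sum_congr rfl fun f hf => ?_
  rw [map_prod]
  refine Finset.prod_congr rfl fun v _ => ?_
  have hadj : Adj v (f v) := ((Finset.mem_filter.1 hf).2 v).2.2
  simp only [substHom, bind₁_X_right, nonEdgeSubst, if_pos hadj]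

/-- Its constant term is the value at `nonEdgePoint`. [folklore] -/
theorem coeff_zero_substHom (h : MvPolynomial (Var n) ℝ≥0) :
    coeff 0 (substHom (nonEdgeSubst n) h) = eval (nonEdgePoint n) h := by
  rw [← constantCoeff_eq]
  change constantCoeff (bind₁ _ h) = _
  rw [hom_bind₁, constantCoeff_comp_C]
  unfold MvPolynomial.eval
  congr 2
  funext p
  simp only [nonEdgeSubst, nonEdgePoint]
  split_ifs <;> simp

/-- **A successful denominator lies in the edge ideal.**  The crux's clause fails for every family `h_n`
having a monomial free of edge variables (`eval (nonEdgePoint n) h_n ≠ 0`). [cite: Valiant1980, §3 Thm 1] -/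
theorem not_divisionEasy_unless_edge_ideal :
    ¬ ∃ c : ℕ, ∀ n : ℕ, ∃ h : MvPolynomial (Var n) ℝ≥0,
      eval (nonEdgePoint n) h ≠ 0 ∧ complexity (triPM n * h) + complexity h ≤ bound c n := by
  rintro ⟨c, H⟩
  apply not_divisionEasy_with_unit_h
  refine ⟨c, fun n => ?_⟩
  obtain ⟨h, hh, hle⟩ := H n
  refine ⟨substHom (nonEdgeSubst n) h, by rw [coeff_zero_substHom]; exact hh, ?_⟩
  have h1 : complexity (triPM n * substHom (nonEdgeSubst n) h) ≤ complexity (triPM n * h) := by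
    have := complexity_subst_le (nonEdgeSubst n) (triPM n * h)
    rwa [map_mul, substHom_triPM] at this
  have h2 := complexity_subst_le (nonEdgeSubst n) h
  omega

end

end Summit.ValiantsHypothesis.ValiantsHypothesis.Theorems.TriangularDimersDivisionEasy.Negative
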